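import Literature.MathematicalPhysics.QuantumChemistry.T1OperatorBoundDQG
import HarnessLib

/-!
# A-priori OPERATOR constants for `T2` SUB-BLOCKS on «DQG ∧ the block as the program writes it», I:
# the fibre engine and `N(|S| + 2)` (`/2` on ordered creator pairs), `S` the annihilator orbitals of the block

Topic `Literature/MathematicalPhysics/QuantumChemistry`; continuation of `T2OperatorBound.lean`
(`N(r+2) · 1 − T2 ⪰ 0` on the `PQGT1T2` rung, engine `posSemidef_sum_smul_one_sub_of_rowBlocks`),
`CompactedThreeIndexOperatorBounds.lean` / `CompactedT2PrimeOperatorBound.lean` (halved constants on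
orbit representatives; `T2′[e₀ ⊕ f]` bordered) and `T1OperatorBoundDQG.lean` (Hermiticity of the
three-index maps on the DQG set; the `T1` family on DQG alone).
HONEST FRAMING (cell chem-oracle, LADDER-CHEM I-TYPE slot 08): statements about a finite model
Hamiltonian's reduced density matrices and their semidefinite relaxations; this file certifies no number.

WHY THIS FILE. An a-priori constant `x̄_k` with `x̄_k · 1 − M_k(y) ⪰ 0` must hold for every `y` in the
RELAXED feasible set of the semidefinite program AS STATED (Jansson 2007 Cor. 6.1 PBQ (ii); the
`lambda_max_bound` member of certsdp's neg-split format). The `T2` / `T2′` constants of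
`T2OperatorBound.lean` / `T2PrimeOperatorBound.lean` are stated on `IsDQGT1T2Feasible` /
`IsDQGT1T2PrimeFeasible` (FULL `T2 ⪰ 0` / `T2′ ⪰ 0`): the Gram-factor engine needs a positive
semidefinite parent. A RESTRICTED three-index program — `D`, `Q`, `G` on all orbitals, `T1`, `T2`, `T2′`
only on an orbital subset or on selected member lists (`RestrictedThreeIndexFeasible.lean`,
`IsDQGRestrictedThreeIndexFeasible N e₁ e₂ e₃`; Nakata et al. (2008) §II.C's inclusions
`E_PQG ≤ E_PQGT1 ≤ E_PQGT1T2 ≤ E_PQGT1T2′` [corpus `paper:doi-10-1063-1-2911696` p0005 L122–L125] extend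
to it) — has a LARGER relaxed feasible set on which full `T2 ⪰ 0` is not available. The repair: take
the parent to be THE BLOCK AS THE PROGRAM WRITES IT (positive semidefinite on the program's own feasible
set by definition) and bound its FIBRES over the annihilator index `k` on the DQG set alone
(`IsDQGFeasible.re_quadForm_t2Map_thirdBlock_le`: `T2_{(··k),(··k)} ⪯ (N + 2γ_kk) · 1`, from `D`, `G`
and Garrod–Percus `Γ ⪯ N · 1` = Chaykin et al. (2016) (4.3) [fetched optimization-online 5730.pdf =
corpus `paper:url-8a9601dd32ed` p0015 L1–L4]). [cite: ChaykinEtAl2016RigorousESC, §4.1 eqs. (4.3), (4.6), p. 15]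

WHAT IS PROVED (0 sorry, no definition, no named fact):
* §1 `posSemidef_sum_smul_one_sub_of_fibers` — the row-block engine for an ARBITRARY block labelling
  `π : σ → K` (fibres instead of the rows of a product): `M ⪰ 0`, `w_k · 1 − M|_{π⁻¹k} ⪰ 0`, `w_k ≥ 0`
  `⇒ (Σ_k w_k) · 1 − M ⪰ 0` (`M = RᴴR`, triangle inequality over the fibre slices, Cauchy–Schwarz;
  Chaykin 2009 (3.44)–(3.45), (3.53)–(3.54) pattern).
* §2 `IsDQGFeasible.posSemidef_smul_one_sub_t2Map_thirdBlock` (`(N + 2γ_kk) · 1 − T2_k ⪰ 0` on the DQG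
  set ALONE; Hermiticity from `T1OperatorBoundDQG.lean`) and `…_thirdBlock_submatrix_half`
  (`((N + 2γ_kk)/2) · 1 − T2_k[f,f] ⪰ 0` for an injective creator-swap-free pair list `f`, pair-orbit
  rule of `CompactedBlockOperatorBounds.lean`).
* §3 MAIN `IsDQGFeasible.posSemidef_smul_one_sub_t2Map_submatrix_of_posSemidef`: for an injective member
  list `e : κ → ι³` whose annihilator indices lie in a `Finset` `S`, `DQG ∧ T2[e,e] ⪰ 0 ⇒
  N(|S|+2) · 1 − T2[e,e] ⪰ 0`; `…_half_…` (`N(|S|+2)/2`, no row the creator-transpose of another).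
* the `T2′` twins (`+1`, bordered), the one-line corollaries on the restricted rung
  `IsDQGRestrictedThreeIndexFeasible` and the `ℝ`-programme shapes are in part II,
  `SubBlockT2PrimeOperatorBounds.lean`.
CONSEQUENCE: the full-rung constant is the case `S = ι` (`|S| = r`); for an orbital-subset block the
gain is `r → |S|` on top of validity. Scale: a `(16e,16o)` model (`N = 16`, `r = 32`), `T2` block with
annihilators in one spin of an 8-orbital subset (`|S| = 8`): `160`, ordered `80` (full-rung value `544`,
not licensed there); `N₂` `r = 56`, `N = 14`, `|S| = 10`: `168` / `84` (full `812`), `T2′` `169` / `85`.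
-/

noncomputable section

namespace Literature.MathematicalPhysics.QuantumChemistry

open Matrix Finset Literature.MathematicalPhysics.QuantumLattice
open scoped ComplexOrder

/-! ### §1 The row-block engine in fibre form -/

section Engine

variable {σ K : Type*} [Fintype σ] [DecidableEq σ] [Fintype K] [DecidableEq K]

/-- `u* · u = Σ_p ‖u_p‖²` (as a complex number; plumbing). [folklore] -/
private theorem star_dotProduct_self_eq_ofReal_sum₄ {m : Type*} [Fintype m] (u : m → ℂ) :
    star u ⬝ᵥ u = ((∑ p, ‖u p‖ ^ 2 : ℝ) : ℂ) := by
  rw [dotProduct, Complex.ofReal_sum]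
  refine Finset.sum_congr rfl fun p _ => ?_
  rw [Pi.star_apply, Complex.star_def, Complex.conj_mul', Complex.ofReal_pow]

/-- A Löwner bound `w · 1 − A ⪰ 0` read on one vector: `Re (c* A c) ≤ w · Σ_j ‖c_j‖²` (plumbing). [folklore] -/
private theorem re_quadForm_le_of_smul_one_sub₄ {m : Type*} [Fintype m] [DecidableEq m]
    {A : Matrix m m ℂ} {w : ℝ} (h : ((w : ℂ) • (1 : Matrix m m ℂ) - A).PosSemidef) (c : m → ℂ) :
    (star c ⬝ᵥ (A *ᵥ c)).re ≤ w * ∑ j, ‖c j‖ ^ 2 := by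
  have h0 := Complex.nonneg_iff.mp (h.dotProduct_mulVec_nonneg c)
  rw [sub_mulVec, smul_mulVec, one_mulVec, dotProduct_sub, dotProduct_smul, smul_eq_mul,
    star_dotProduct_self_eq_ofReal_sum₄, ← Complex.ofReal_mul, Complex.sub_re, Complex.ofReal_re] at h0
  linarith [h0.1]

omit [DecidableEq σ] [Fintype K] in
/-- A sum over a fibre as a masked sum over the whole index set (plumbing). [folklore] -/
private theorem sum_fiber_eq_sum_ite {β : Type*} [AddCommMonoid β] (π : σ → K) (k : K) (g : σ → β) :
    ∑ c : {s // π s = k}, g c.1 = ∑ s, if π s = k then g s else 0 := by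
  rw [← Finset.sum_subtype (Finset.univ.filter fun s => π s = k) (p := fun s => π s = k)
    (fun s => by simp) g, Finset.sum_filter]

/-- **The row-block engine in fibre form.** If `M ⪰ 0` on an index set `σ` labelled by `π : σ → K`
and every FIBRE block is bounded, `w_k · 1 − M|_{π⁻¹(k)} ⪰ 0` with `w_k ≥ 0`, then
`(Σ_k w_k) · 1 − M ⪰ 0`. (`M = RᴴR`; split `x` into its fibre slices `x_k`:
`‖Rx‖ ≤ Σ_k ‖Rx_k‖ ≤ Σ_k w_k^{1/2}‖x_k‖ ≤ (Σ_k w_k)^{1/2}‖x‖`; the product-indexed case is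
`posSemidef_sum_smul_one_sub_of_rowBlocks`, Chaykin 2009 (3.44)–(3.45), (3.53)–(3.54) pattern.)
[cite: Chaykin2009Thesis, §3.4.1 eqs. (3.44)-(3.45), (3.53)-(3.54), pp. 36-38] -/
theorem posSemidef_sum_smul_one_sub_of_fibers {M : Matrix σ σ ℂ} (hM : M.PosSemidef) (π : σ → K)
    {w : K → ℝ} (hw : ∀ k, 0 ≤ w k)
    (hblock : ∀ k, ((w k : ℂ) • (1 : Matrix {s // π s = k} {s // π s = k} ℂ) -
      M.submatrix Subtype.val Subtype.val).PosSemidef) :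
    (((∑ k, w k : ℝ) : ℂ) • (1 : Matrix σ σ ℂ) - M).PosSemidef := by
  classical
  obtain ⟨R, hR⟩ :=
    Literature.LinearAlgebra.Matrix.exists_eq_conjTranspose_mul_self_of_posSemidef hM
  -- the quadratic form of `M` is a sum of squares
  have hquad : ∀ v : σ → ℂ, star v ⬝ᵥ (M *ᵥ v) = ((∑ p, ‖(R *ᵥ v) p‖ ^ 2 : ℝ) : ℂ) := by
    intro v
    rw [hR, ← mulVec_mulVec, dotProduct_mulVec, ← star_mulVec, star_dotProduct_self_eq_ofReal_sum₄]
  -- `v ↦ R v` as a map into Euclidean space: its norm squared is the quadratic form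
  let L : (σ → ℂ) →ₗ[ℂ] EuclideanSpace ℂ σ :=
    (WithLp.linearEquiv 2 ℂ (σ → ℂ)).symm.toLinearMap ∘ₗ R.mulVecLin
  have hLapply : ∀ v p, L v p = (R *ᵥ v) p := fun v p => rfl
  have hL : ∀ v, ‖L v‖ ^ 2 = (star v ⬝ᵥ (M *ᵥ v)).re := by
    intro v
    rw [EuclideanSpace.norm_sq_eq, hquad, Complex.ofReal_re]
    simp only [hLapply]
  -- Hermitian part of the claim
  have hherm : (((∑ k, w k : ℝ) : ℂ) • (1 : Matrix σ σ ℂ) - M).IsHermitian := by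
    have h1 : (((∑ k, w k : ℝ) : ℂ) • (1 : Matrix σ σ ℂ)).IsHermitian := by
      rw [IsHermitian, conjTranspose_smul, conjTranspose_one, Complex.star_def, Complex.conj_ofReal]
    exact h1.sub hM.1
  refine PosSemidef.of_dotProduct_mulVec_nonneg hherm fun x => ?_
  -- fibre slices of `x` and their squared norms
  set V : K → (σ → ℂ) := fun k p => if π p = k then x p else 0 with hV
  set m : K → ℝ := fun k => ∑ c : {s // π s = k}, ‖x c.1‖ ^ 2 with hm
  have hm0 : ∀ k, 0 ≤ m k := fun k => Finset.sum_nonneg fun j _ => sq_nonneg _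
  have hxV : x = ∑ k, V k := by
    ext p
    simp only [hV, Finset.sum_apply, Finset.sum_ite_eq, Finset.mem_univ, if_true]
  have hsum_m : ∑ k, m k = ∑ p, ‖x p‖ ^ 2 := by
    simp only [hm]
    exact Fintype.sum_fiberwise π (fun p => ‖x p‖ ^ 2)
  -- the quadratic form on a fibre slice is the quadratic form of the fibre block
  have hVquad : ∀ k, star (V k) ⬝ᵥ (M *ᵥ V k) =
      star (fun c : {s // π s = k} => x c.1) ⬝ᵥ
        (M.submatrix Subtype.val Subtype.val *ᵥ fun c : {s // π s = k} => x c.1) := by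
    intro k
    have hrhs : star (fun c : {s // π s = k} => x c.1) ⬝ᵥ
        (M.submatrix Subtype.val Subtype.val *ᵥ fun c : {s // π s = k} => x c.1) =
        ∑ c : {s // π s = k}, star (x c.1) * ∑ d : {s // π s = k}, M c.1 d.1 * x d.1 := by
      simp only [dotProduct, mulVec, submatrix_apply, Pi.star_apply]
    have hlhs : star (V k) ⬝ᵥ (M *ᵥ V k) =
        ∑ p, if π p = k then star (x p) * ∑ q, (if π q = k then M p q * x q else 0) else 0 := by
      simp only [dotProduct, mulVec, Pi.star_apply, hV]
      refine Finset.sum_congr rfl fun p _ => ?_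
      by_cases hp : π p = k
      · simp only [hp, if_true]
        congr 1
        refine Finset.sum_congr rfl fun q _ => ?_
        by_cases hq : π q = k
        · simp only [hq, if_true]
        · simp only [hq, if_false, mul_zero]
      · simp only [hp, if_false, star_zero, zero_mul]
    rw [hlhs, hrhs, sum_fiber_eq_sum_ite π k (fun p => star (x p) * ∑ d : {s // π s = k}, M p d.1 * x d.1)]
    refine Finset.sum_congr rfl fun p _ => ?_
    by_cases hp : π p = k
    · simp only [hp, if_true]
      rw [sum_fiber_eq_sum_ite π k (fun q => M p q * x q)]
    · simp only [hp, if_false]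
  -- each slice: `‖R x_k‖ ≤ √w_k · √m_k`
  have hVnorm : ∀ k, ‖L (V k)‖ ≤ Real.sqrt (w k) * Real.sqrt (m k) := by
    intro k
    have h1 : ‖L (V k)‖ ^ 2 ≤ w k * m k := by
      rw [hL, hVquad]
      exact re_quadForm_le_of_smul_one_sub₄ (hblock k) _
    calc ‖L (V k)‖ = Real.sqrt (‖L (V k)‖ ^ 2) := (Real.sqrt_sq (norm_nonneg _)).symm
      _ ≤ Real.sqrt (w k * m k) := Real.sqrt_le_sqrt h1
      _ = Real.sqrt (w k) * Real.sqrt (m k) := Real.sqrt_mul (hw k) _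
  -- the real inequality `Re (x* M x) ≤ (Σ w) · ‖x‖²`
  have hmain : (star x ⬝ᵥ (M *ᵥ x)).re ≤ (∑ k, w k) * ∑ p, ‖x p‖ ^ 2 := by
    have htri : ‖L x‖ ≤ ∑ k, ‖L (V k)‖ := by
      rw [hxV, map_sum]
      exact norm_sum_le _ _
    have h2 : ∑ k, ‖L (V k)‖ ≤ ∑ k, Real.sqrt (w k) * Real.sqrt (m k) :=
      Finset.sum_le_sum fun k _ => hVnorm k
    have h3 : (∑ k, Real.sqrt (w k) * Real.sqrt (m k)) ^ 2 ≤ (∑ k, w k) * ∑ k, m k := by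
      have hcs := Finset.sum_mul_sq_le_sq_mul_sq Finset.univ
        (fun k => Real.sqrt (w k)) (fun k => Real.sqrt (m k))
      have e1 : ∀ k, Real.sqrt (w k) ^ 2 = w k := fun k => Real.sq_sqrt (hw k)
      have e2 : ∀ k, Real.sqrt (m k) ^ 2 = m k := fun k => Real.sq_sqrt (hm0 k)
      simp only [e1, e2] at hcs
      exact hcs
    have h4 : ‖L x‖ ^ 2 ≤ (∑ k, Real.sqrt (w k) * Real.sqrt (m k)) ^ 2 := by
      have h0 : 0 ≤ ‖L x‖ := norm_nonneg _
      have h5 := htri.trans h2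
      nlinarith
    rw [← hL, ← hsum_m]
    exact h4.trans h3
  -- assemble the complex inequality
  have him : (star x ⬝ᵥ (M *ᵥ x)).im = 0 := by rw [hquad, Complex.ofReal_im]
  rw [sub_mulVec, smul_mulVec, one_mulVec, dotProduct_sub, dotProduct_smul, smul_eq_mul,
    star_dotProduct_self_eq_ofReal_sum₄, ← Complex.ofReal_mul, Complex.nonneg_iff, Complex.sub_re,
    Complex.ofReal_re, Complex.sub_im, Complex.ofReal_im, him, sub_zero]
  exact ⟨by linarith, rfl⟩

/-- Monotonicity of a Löwner bound in its constant (plumbing): `c ≤ c'`, `c · 1 − M ⪰ 0 ⇒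
c' · 1 − M ⪰ 0`. [folklore] -/
private theorem posSemidef_smul_one_sub_mono {m : Type*} [Fintype m] [DecidableEq m] {M : Matrix m m ℂ}
    {c c' : ℝ} (hcc' : c ≤ c') (h : ((c : ℂ) • (1 : Matrix m m ℂ) - M).PosSemidef) :
    ((c' : ℂ) • (1 : Matrix m m ℂ) - M).PosSemidef := by
  have h1 : ((((c' - c : ℝ)) : ℂ) • (1 : Matrix m m ℂ)).PosSemidef :=
    PosSemidef.one.smul (Complex.zero_le_real.2 (sub_nonneg.2 hcc'))
  have h2 := h1.add h
  rwa [← add_sub_assoc, ← add_smul, ← Complex.ofReal_add, sub_add_cancel] at h2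

end Engine

/-! ### §2 The third-index block of `T2` on the DQG set alone -/

section ThirdBlock

variable {ι : Type*} [LinearOrder ι] [Fintype ι] {N : ℕ} {γ : Matrix ι ι ℂ}
  {Γ : Matrix (ι × ι) (ι × ι) ℂ}

/-- **`(N + 2γ_kk) · 1 − T2_{(··k),(··k)} ⪰ 0` on the DQG-feasible set ALONE** (no `T2 ⪰ 0`): the
quadratic-form estimate `IsDQGFeasible.re_quadForm_t2Map_thirdBlock_le` (`D`, `G`, Garrod–Percus (4.3))
and the Hermiticity of `t2Map` on the DQG set (`IsDQGFeasible.t2Map_isHermitian`).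
[cite: ChaykinEtAl2016RigorousESC, §4.1 eqs. (4.3), (4.6), p. 15] -/
theorem IsDQGFeasible.posSemidef_smul_one_sub_t2Map_thirdBlock (h : IsDQGFeasible N γ Γ) (k : ι) :
    (((((N : ℝ) + 2 * (γ k k).re : ℝ)) : ℂ) • (1 : Matrix (ι × ι) (ι × ι) ℂ) -
      (t2Map γ Γ).submatrix (fun p : ι × ι => (p.1, p.2, k)) (fun p : ι × ι => (p.1, p.2, k))).PosSemidef :=
  posSemidef_smul_one_sub_of_re_quadForm_le (h.t2Map_isHermitian.submatrix _)
    (h.re_quadForm_t2Map_thirdBlock_le k)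

/-- **Half the constant on a creator-swap-free pair list**: for an injective `f : l → ι × ι` with no
member the transpose of another, `((N + 2γ_kk)/2) · 1 − T2_k[f,f] ⪰ 0` on the DQG set alone — the
pair-orbit rule `posSemidef_half_smul_one_sub_submatrix_of_pair` for the parent `T2_k` (alternating in
the creator pair, `t2Map_swap₁₂_left`; Hermitian on the DQG set). ("`g_{i,j,k}` antisymmetric in
`(j,k)`", Braams–Percus–Zhao §II.) [cite: BraamsPercusZhao2007, §II eqs. (4)-(5)] -/
theorem IsDQGFeasible.posSemidef_half_smul_one_sub_t2Map_thirdBlock_submatrix (h : IsDQGFeasible N γ Γ)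
    (k : ι) {l : Type*} [Fintype l] [DecidableEq l] {f : l → ι × ι} (hf : Function.Injective f)
    (hfree : ∀ i j, f i ≠ ((f j).2, (f j).1)) :
    ((((((N : ℝ) + 2 * (γ k k).re) / 2 : ℝ)) : ℂ) • (1 : Matrix l l ℂ) -
      (t2Map γ Γ).submatrix (fun i => ((f i).1, (f i).2, k)) (fun i => ((f i).1, (f i).2, k))).PosSemidef := by
  have H := posSemidef_half_smul_one_sub_submatrix_of_pair _ (h.t2Map_isHermitian.submatrix _)
    (h.posSemidef_smul_one_sub_t2Map_thirdBlock k) hf (e₁ := fun i => ((f i).2, (f i).1))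
    (fun i j hij => hf ?_) hfree (fun i r => t2Map_swap₁₂_left γ h.swap_fst _ _ _ _)
  · rw [Complex.ofReal_div] at *
    push_cast at H ⊢
    exact H
  · simp only [Prod.mk.injEq] at hij
    exact Prod.ext hij.2 hij.1

end ThirdBlock

/-! ### §3 `T2` sub-blocks: `N(|S|+2)` on «DQG ∧ the block ⪰ 0» -/

section SubBlock

variable {ι : Type*} [LinearOrder ι] [Fintype ι] {N : ℕ} {γ : Matrix ι ι ℂ}
  {Γ : Matrix (ι × ι) (ι × ι) ℂ} {κ : Type*} [Fintype κ] [DecidableEq κ]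

/-- Re-indexing a Löwner bound along an injective map (plumbing). [folklore] -/
private theorem submatrix_smul_one_sub₄ {m l : Type*} [DecidableEq m] [DecidableEq l] (c : ℂ)
    (A : Matrix m m ℂ) {e : l → m} (he : Function.Injective e) :
    (c • (1 : Matrix m m ℂ) - A).submatrix e e = c • (1 : Matrix l l ℂ) - A.submatrix e e := by
  ext i j
  simp only [submatrix_apply, Matrix.sub_apply, Matrix.smul_apply, Matrix.one_apply, he.eq_iff]

/-- The sum of the fibre constants `N + 2γ_kk` over the annihilator orbitals `S` is at most `N(|S|+2)`
(`0 ≤ γ_kk`, `Σ_k γ_kk = N`; plumbing). [folklore] -/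
private theorem IsDQGFeasible.sum_fiber_const_le (h : IsDQGFeasible N γ Γ) (S : Finset ι) :
    ∑ k : S, ((N : ℝ) + 2 * (γ k k).re) ≤ (N : ℝ) * (S.card + 2) := by
  rw [Finset.sum_coe_sort S (fun k => (N : ℝ) + 2 * (γ k k).re), Finset.sum_add_distrib,
    Finset.sum_const, nsmul_eq_mul, ← Finset.mul_sum]
  have hsub : ∑ k ∈ S, (γ k k).re ≤ ∑ k, (γ k k).re :=
    Finset.sum_le_univ_sum_of_nonneg fun k => (h.diag_nonneg k).1
  have htr : ∑ k, (γ k k).re = N := by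
    have := congrArg Complex.re h.trace_one
    rwa [Complex.re_sum, Complex.natCast_re] at this
  nlinarith

/-- **MAIN: `x̄ = N(|S|+2)` for any `T2` sub-block the program writes.** On the DQG-feasible set, for
every injective member list `e : κ → ι × ι × ι` of triples `(creator, creator, annihilator)` whose
annihilator indices lie in the `Finset` `S`, IF the block `T2[e,e]` is positive semidefinite (as it is
on the relaxed feasible set of any program that writes it as a PSD block — a restricted
`DQG + … + T2[e]` program, or the full rung), THEN `N(|S|+2) · 1 − T2[e,e] ⪰ 0`. Proof: the fibre
engine over the annihilator index, each fibre being a principal submatrix of `T2_{(··k),(··k)} ⪯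
(N + 2γ_kk) · 1` (DQG alone), and `Σ_{k∈S} (N + 2γ_kk) ≤ N(|S|+2)`. The full-rung constant `N(r+2)` is
the case `S = univ`; for an orbital-subset block, `|S| ≤ |A|` (one annihilator spin) or `2|A|`.
[cite: ChaykinEtAl2016RigorousESC, §4.1 eqs. (4.3), (4.6), p. 15] -/
theorem IsDQGFeasible.posSemidef_smul_one_sub_t2Map_submatrix_of_posSemidef (h : IsDQGFeasible N γ Γ)
    {e : κ → ι × ι × ι} (he : Function.Injective e)
    (hT : ((t2Map γ Γ).submatrix e e).PosSemidef) {S : Finset ι} (hS : ∀ c, (e c).2.2 ∈ S) :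
    (((N : ℂ) * (S.card + 2)) • (1 : Matrix κ κ ℂ) - (t2Map γ Γ).submatrix e e).PosSemidef := by
  -- label the members by their annihilator orbital, an element of `S`
  let π : κ → S := fun c => ⟨(e c).2.2, hS c⟩
  have hπ : ∀ c, ((π c : S) : ι) = (e c).2.2 := fun c => rfl
  have heng := posSemidef_sum_smul_one_sub_of_fibers hT π
    (w := fun k : S => (N : ℝ) + 2 * (γ k k).re)
    (fun k => by have := (h.diag_nonneg (k : ι)).1; positivity) fun k => by
      -- the fibre over `k` is a principal submatrix of the third-index block `T2_k`
      let g : {c // π c = k} → ι × ι := fun c => ((e c.1).1, (e c.1).2.1)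
      have hk : ∀ c : {c // π c = k}, (e c.1).2.2 = (k : ι) := fun c => by
        rw [← hπ]; exact congrArg Subtype.val c.2
      have hg : Function.Injective g := by
        intro c d hcd
        simp only [g, Prod.mk.injEq] at hcd
        apply Subtype.ext
        apply he
        exact Prod.ext hcd.1 (Prod.ext hcd.2 ((hk c).trans (hk d).symm))
      have hrow : ∀ c : {c // π c = k}, e c.1 = ((e c.1).1, (e c.1).2.1, (k : ι)) := fun c => by
        rw [← hk c]
      have hsub : ((t2Map γ Γ).submatrix e e).submatrix Subtype.val Subtype.val =
          ((t2Map γ Γ).submatrix (fun p : ι × ι => (p.1, p.2, (k : ι)))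
            (fun p : ι × ι => (p.1, p.2, (k : ι)))).submatrix g g := by
        ext c d
        simp only [submatrix_apply, g]
        rw [← hrow c, ← hrow d]
      rw [hsub, ← submatrix_smul_one_sub₄ _ _ hg]
      exact (h.posSemidef_smul_one_sub_t2Map_thirdBlock (k : ι)).submatrix g
  have hle := h.sum_fiber_const_le S
  have hmono := posSemidef_smul_one_sub_mono hle heng
  have hcast : ((((N : ℝ) * (S.card + 2) : ℝ)) : ℂ) = (N : ℂ) * (S.card + 2) := by push_cast; ring
  rw [hcast] at hmono
  exact hmono

/-- **`x̄ = N(|S|+2)/2` for a COMPACTED `T2` sub-block** (no member the creator-transpose `(j,i,k)` of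
another, e.g. rows with `i < j`): same hypotheses, half the constant — the fibres are creator-swap-free
pair lists, bounded by `((N + 2γ_kk)/2) · 1` (`…_thirdBlock_submatrix`).
[cite: BraamsPercusZhao2007, §II eqs. (4)-(5)] -/
theorem IsDQGFeasible.posSemidef_half_smul_one_sub_t2Map_submatrix_of_posSemidef
    (h : IsDQGFeasible N γ Γ) {e : κ → ι × ι × ι} (he : Function.Injective e)
    (hfree : ∀ i j, e i ≠ ((e j).2.1, (e j).1, (e j).2.2))
    (hT : ((t2Map γ Γ).submatrix e e).PosSemidef) {S : Finset ι} (hS : ∀ c, (e c).2.2 ∈ S) :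
    (((N : ℂ) * (S.card + 2) / 2) • (1 : Matrix κ κ ℂ) - (t2Map γ Γ).submatrix e e).PosSemidef := by
  let π : κ → S := fun c => ⟨(e c).2.2, hS c⟩
  have hπ : ∀ c, ((π c : S) : ι) = (e c).2.2 := fun c => rfl
  have heng := posSemidef_sum_smul_one_sub_of_fibers hT π
    (w := fun k : S => ((N : ℝ) + 2 * (γ k k).re) / 2)
    (fun k => by have := (h.diag_nonneg (k : ι)).1; positivity) fun k => by
      let g : {c // π c = k} → ι × ι := fun c => ((e c.1).1, (e c.1).2.1)
      have hk : ∀ c : {c // π c = k}, (e c.1).2.2 = (k : ι) := fun c => by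
        rw [← hπ]; exact congrArg Subtype.val c.2
      have hg : Function.Injective g := by
        intro c d hcd
        simp only [g, Prod.mk.injEq] at hcd
        apply Subtype.ext
        apply he
        exact Prod.ext hcd.1 (Prod.ext hcd.2 ((hk c).trans (hk d).symm))
      have hgfree : ∀ c d : {c // π c = k}, g c ≠ ((g d).2, (g d).1) := by
        intro c d hcd
        simp only [g, Prod.mk.injEq] at hcd
        apply hfree c.1 d.1
        exact Prod.ext hcd.1 (Prod.ext hcd.2 ((hk c).trans (hk d).symm))
      have hrow : ∀ c : {c // π c = k}, e c.1 = ((e c.1).1, (e c.1).2.1, (k : ι)) := fun c => by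
        rw [← hk c]
      have hsub : ((t2Map γ Γ).submatrix e e).submatrix Subtype.val Subtype.val =
          (t2Map γ Γ).submatrix (fun c => ((g c).1, (g c).2, (k : ι)))
            (fun c => ((g c).1, (g c).2, (k : ι))) := by
        ext c d
        simp only [submatrix_apply, g]
        rw [← hrow c, ← hrow d]
      rw [hsub]
      exact h.posSemidef_half_smul_one_sub_t2Map_thirdBlock_submatrix (k : ι) hg hgfree
  have hle : ∑ k : S, ((N : ℝ) + 2 * (γ k k).re) / 2 ≤ (N : ℝ) * (S.card + 2) / 2 := by
    rw [← Finset.sum_div]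
    exact div_le_div_of_nonneg_right (h.sum_fiber_const_le S) zero_le_two
  have hmono := posSemidef_smul_one_sub_mono hle heng
  have hcast : ((((N : ℝ) * (S.card + 2) / 2 : ℝ)) : ℂ) = (N : ℂ) * (S.card + 2) / 2 := by
    push_cast; ring
  rw [hcast] at hmono
  exact hmono

end SubBlock

end Literature.MathematicalPhysics.QuantumChemistry

end
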